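import Summits.Ventures.LatticeQCDFlow.TrivializingMaps.FisherZeroRadiusBound
import Summits.Ventures.LatticeQCDFlow.TrivializingMaps.FisherStaircaseCumulants
import Summits.Ventures.LatticeQCDFlow.TrivializingMaps.WilsonPinching

/-!
HONEST FRAMING: exact (Metropolis-corrected) sampling algorithms for lattice gauge theory; figures
of merit are autocorrelation/cost numbers at stated couplings and volumes; no continuum-physics
claim.

# FisherZeroNearCoupling — A LARGE SPECIFIC HEAT AT COUPLING `x` FORCES A FISHER ZERO NEAR `x`, AND
# SHORTENS EVERY STAIRCASE STAGE CENTRED AT `x` (lean-2 GEN-6, ours)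

Venture-side (OURS).  Cell `lqcd-flow` (pub-lqcd), unit `pub-lqcd-lean-2-g6`, 2026-08-22.  The
quantitative zero-radius bound of `FisherZeroRadiusBound` (`Var X > 128(|b|R+1)/R²` ⟹ a zero of the
complex MGF with `|z| < R`), RE-BASED from the trivial theory to the ensemble at an arbitrary real
coupling `x` through the tilted-measure dictionary of `FisherStaircaseCumulants`
(`𝒵⁻¹e^{-xS}D[U] = D[U].tilted(-xS)`; `T_x(1) = Var_{μ_x}(S)`):

* `complexMGF_tilted_mul` — the complex MGF of `X` under the tilted law `μ_x = μ.tilted(xX)` is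
  `u ↦ Z(x+u)/Z(x)` (`Z = complexMGF X μ`): its zeros are the zeros of `Z` translated by `-x`.
* **`exists_zero_near_of_variance_tilted_gt`** — `|X| ≤ b` a.e., `Var_{μ_x}(X) > 128(|b|R + 1)/R²`
  ⟹ `Z(z) = 0` for some `|z - x| < R`.
* Docked (`Z(s) = ∫ D[U] e^{-sS}`, `μ_x = 𝒵⁻¹ e^{-xS} D[U]` = the theory AT COUPLING `x`):
  **`exists_actionZ_eq_zero_near_of_variance_gt`** — `Var_{μ_x}(S∘ι) > 128(|b|R+1)/R²`, `|S∘ι| ≤ b`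
  ⟹ a Fisher zero `s₀` with `|s₀ - x| < R`; `infDist_actionZ_zeroSet_lt_of_variance_gt` —
  `dist(x, F_Z) < R`; and **`Staircase.step_le_of_variance_gt`** — every `η`-margined staircase
  stage centred at `x` then has step `Δ < (1-η)R`: A LARGE VARIANCE OF THE ACTION (volume × specific
  heat) AT COUPLING `x` SHORTENS THE STAGE AT `x`, in every volume (THEOREM S's `dist(x, F_Z)` made
  observable).
* Wilson: `wilson_exists_fisherZero_near_of_variance_gt` — the same with `μ_x = wilsonMeasure ρ₀ x`
  and `b = 2n·#plaquettes` (tree `abs_wilsonAction_le`): a zero of `Z_L` within `R` of the real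
  coupling `x` as soon as `Var_{wilsonMeasure ρ₀ x}(S_W) > 128(2n·#plaquettes·R + 1)/R²` — per
  plaquette: specific heat `c_x = Var_x(S_W)/#plaq > 256n/R + 128/(#plaq·R²)`, uniformly in `L`.

NOT CLAIMED: any value of a specific heat, zero or distance for any `L`, `β`; that a specific-heat
peak exists; anything about cost, autocorrelation or the continuum.  Classical background (not used):
Fisher 1965 / Itzykson–Pearson–Zuber 1983 (zeros pinch the real axis where the specific heat
diverges); here a finite-volume, kernel-checked inequality in the opposite logical direction.
-/

open MeasureTheory ProbabilityTheory Filter Topology Complex Set Metric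
open Literature.MathematicalPhysics.QuantumFieldTheory
open Literature.MathematicalPhysics.QuantumFieldTheory.Luscher2010
open Literature.MathematicalPhysics.QuantumFieldTheory.WilsonFlow (coeConfig continuous_coeConfig)
open scoped Matrix Matrix.Norms.Frobenius ContDiff

namespace Summit.Ventures.LatticeQCDFlow.TrivializingMaps

/-! ## §1 The complex MGF under a tilted law -/

section General

variable {Ω : Type*} [MeasurableSpace Ω] {μ : Measure Ω} [IsProbabilityMeasure μ]
  {X : Ω → ℝ} {b : ℝ}

omit [IsProbabilityMeasure μ] in
/-- **The complex MGF of `X` under `μ.tilted (xX)` is `u ↦ Z(x+u)/Z(x)`.** [folklore] -/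
theorem complexMGF_tilted_mul (x : ℝ) (u : ℂ) :
    complexMGF X (μ.tilted fun y => x * X y) u =
      complexMGF X μ (x + u) / (mgf X μ x : ℂ) := by
  simp only [complexMGF]
  rw [integral_tilted_mul_eq_mgf, div_eq_mul_inv (∫ y, cexp ((↑x + u) * ↑(X y)) ∂μ),
    ← MeasureTheory.integral_mul_const]
  refine integral_congr_ae (ae_of_all _ fun y => ?_)
  simp only [Complex.real_smul, Complex.ofReal_div, Complex.ofReal_exp, Complex.ofReal_mul, add_mul,
    Complex.exp_add]
  ring

/-- **A large variance in the tilted ensemble at `x` forces a zero near `x`.**  If `|X| ≤ b` a.e.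
and `Var_{μ.tilted(xX)}(X) > 128(|b|R + 1)/R²` (`R > 0`), then `∫ e^{zX} dμ = 0` for some
`|z - x| < R`. [ours] -/
theorem exists_zero_near_of_variance_tilted_gt (hm : AEMeasurable X μ) (hb : ∀ᵐ u ∂μ, |X u| ≤ b)
    (x : ℝ) {R : ℝ} (hR : 0 < R)
    (hvar : 128 * (|b| * R + 1) / R ^ 2 < variance X (μ.tilted fun y => x * X y)) :
    ∃ z : ℂ, ‖z - x‖ < R ∧ complexMGF X μ z = 0 := by
  have hint : Integrable (fun y => Real.exp (x * X y)) μ :=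
    integrable_exp_mul_of_mem_Icc hm (hb.mono fun _ h => mem_Icc.2 (abs_le.1 h))
  haveI : IsProbabilityMeasure (μ.tilted fun y => x * X y) := isProbabilityMeasure_tilted hint
  have hm' : AEMeasurable X (μ.tilted fun y => x * X y) :=
    hm.mono_ac (tilted_absolutelyContinuous _ _)
  have hb' : ∀ᵐ u ∂(μ.tilted fun y => x * X y), |X u| ≤ b :=
    (tilted_absolutelyContinuous _ _).ae_le hb
  obtain ⟨u, hu, hZ⟩ := exists_zero_norm_lt_of_variance_gt hm' hb' hR hvar
  refine ⟨x + u, by simpa using hu, ?_⟩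
  rw [complexMGF_tilted_mul] at hZ
  rcases div_eq_zero_iff.mp hZ with h | h
  · exact h
  · exact absurd (by exact_mod_cast h : mgf X μ x = 0) (mgf_pos hint).ne'

end General

/-! ## §2 Docked: a Fisher zero near the coupling where the action fluctuates strongly -/

section ActionZ

variable {d L n : ℕ} [NeZero L] {S : AmbConfig d L n → ℝ}

/-- The ensemble at coupling `x`, `𝒵⁻¹ e^{-xS} D[U]`, is `D[U]` tilted by `x·(-S∘ι)`. [folklore] -/
theorem boltzmannMeasure_smul_eq_tilted (hS : ContDiff ℝ ∞ S) (x : ℝ) :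
    (boltzmannMeasure fun U : GaugeConfig d L (Matrix.specialUnitaryGroup (Fin n) ℂ) =>
        x * S (coeConfig U)) =
      (trivialMeasure (Matrix.specialUnitaryGroup (Fin n) ℂ) d L).tilted
        fun U => x * (-S (coeConfig U)) := by
  have hcont : Continuous fun U : GaugeConfig d L (Matrix.specialUnitaryGroup (Fin n) ℂ) =>
      x * S (coeConfig U) := continuous_const.mul (continuous_comp_coeConfig hS)
  rw [boltzmannMeasure_eq_tilted hcont]
  congr 1
  funext U
  ring

/-- **A Fisher zero within `R` of the coupling `x` from the variance of the action at `x`.**  For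
a smooth action with `|S∘ι| ≤ b`: if the ensemble `𝒵⁻¹e^{-xS}D[U]` has
`Var(S∘ι) > 128(|b|R + 1)/R²` (`R > 0`), then `Z(s₀) = 0` for some `|s₀ - x| < R`. [ours] -/
theorem exists_actionZ_eq_zero_near_of_variance_gt (hS : ContDiff ℝ ∞ S) {b : ℝ}
    (hb : ∀ U : GaugeConfig d L (Matrix.specialUnitaryGroup (Fin n) ℂ), |S (coeConfig U)| ≤ b)
    (x : ℝ) {R : ℝ} (hR : 0 < R)
    (hvar : 128 * (|b| * R + 1) / R ^ 2 < variance (fun U => S (coeConfig U))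
      (boltzmannMeasure fun U : GaugeConfig d L (Matrix.specialUnitaryGroup (Fin n) ℂ) =>
        x * S (coeConfig U))) :
    ∃ s₀ : ℂ, ‖s₀ - x‖ < R ∧ complexMGF (fun U => -S (coeConfig U))
      (trivialMeasure (Matrix.specialUnitaryGroup (Fin n) ℂ) d L) s₀ = 0 := by
  have hm : AEMeasurable (fun U => -S (coeConfig U))
      (trivialMeasure (Matrix.specialUnitaryGroup (Fin n) ℂ) d L) :=
    (integrable_trivialMeasure_of_continuous (continuous_comp_coeConfig hS).neg).aemeasurable
  refine exists_zero_near_of_variance_tilted_gt (b := b) hm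
    (ae_of_all _ fun U => by simpa using hb U) x hR ?_
  rw [variance_fun_neg, ← boltzmannMeasure_smul_eq_tilted hS x]
  exact hvar

/-- `dist(x, F_Z) < R` under the same hypothesis. [ours] -/
theorem infDist_actionZ_zeroSet_lt_of_variance_gt (hS : ContDiff ℝ ∞ S) {b : ℝ}
    (hb : ∀ U : GaugeConfig d L (Matrix.specialUnitaryGroup (Fin n) ℂ), |S (coeConfig U)| ≤ b)
    (x : ℝ) {R : ℝ} (hR : 0 < R)
    (hvar : 128 * (|b| * R + 1) / R ^ 2 < variance (fun U => S (coeConfig U))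
      (boltzmannMeasure fun U : GaugeConfig d L (Matrix.specialUnitaryGroup (Fin n) ℂ) =>
        x * S (coeConfig U))) :
    infDist (x : ℂ) {s : ℂ | complexMGF (fun U => -S (coeConfig U))
      (trivialMeasure (Matrix.specialUnitaryGroup (Fin n) ℂ) d L) s = 0} < R := by
  obtain ⟨s₀, hs₀, hz⟩ := exists_actionZ_eq_zero_near_of_variance_gt hS hb x hR hvar
  refine lt_of_le_of_lt (infDist_le_dist_of_mem (by exact hz)) ?_
  rwa [dist_comm, dist_eq_norm]

/-- **LARGE FLUCTUATIONS SHORTEN THE STAGE** (THEOREM S made observable): if the ensemble at the real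
coupling `x` has `Var(S∘ι) > 128(|b|R + 1)/R²`, then every staircase stage centred at `x` that is
summable at `x + Δ/(1-η)` (`Δ ≥ 0`, `η < 1`) has `Δ < (1-η)R`. [ours] -/
theorem Staircase.step_lt_of_variance_gt (hS : ContDiff ℝ ∞ S) {b : ℝ}
    (hb : ∀ U : GaugeConfig d L (Matrix.specialUnitaryGroup (Fin n) ℂ), |S (coeConfig U)| ≤ b)
    {x Δ η R : ℝ} (hΔ : 0 ≤ Δ) (hη : η < 1) (hR : 0 < R)
    (hvar : 128 * (|b| * R + 1) / R ^ 2 < variance (fun U => S (coeConfig U))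
      (boltzmannMeasure fun U : GaugeConfig d L (Matrix.specialUnitaryGroup (Fin n) ℂ) =>
        x * S (coeConfig U)))
    (hsum : Summable fun k : ℕ => (k.factorial : ℂ)⁻¹ *
      iteratedDeriv k (fun w => deriv (complexMGF (fun U => -S (coeConfig U))
          (trivialMeasure (Matrix.specialUnitaryGroup (Fin n) ℂ) d L)) w /
        complexMGF (fun U => -S (coeConfig U))
          (trivialMeasure (Matrix.specialUnitaryGroup (Fin n) ℂ) d L) w) x *
      (((x + Δ / (1 - η) : ℝ) : ℂ) - x) ^ k) :
    Δ < (1 - η) * R := by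
  obtain ⟨s₀, hs₀, hz⟩ := exists_actionZ_eq_zero_near_of_variance_gt hS hb x hR hvar
  have h := Staircase.step_le_of_stage_summable (d := d) (L := L) (n := n) hS hΔ hη hsum hz
  have h1η : 0 < 1 - η := sub_pos.mpr hη
  calc Δ ≤ (1 - η) * ‖(x : ℂ) - s₀‖ := h
    _ < (1 - η) * R := by
        refine mul_lt_mul_of_pos_left ?_ h1η
        rwa [norm_sub_rev]

end ActionZ

/-! ## §3 Wilson action: a zero of `Z_L` near `x` from the specific heat at coupling `x` -/

section Wilson

variable {d L n : ℕ} [NeZero L]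

/-- `|S_W(ιU)| ≤ 2n · #plaquettes` (tree `abs_wilsonAction_le` through the dictionary
`ambWilsonAction (ιU) = wilsonAction ρ₀ U`). [folklore] -/
theorem abs_ambWilsonAction_coeConfig_le
    (U : GaugeConfig d L (Matrix.specialUnitaryGroup (Fin n) ℂ)) :
    |ambWilsonAction (coeConfig U)| ≤ 2 * n * Fintype.card (Plaquette d L) := by
  rw [StrongCoupling.ambWilsonAction_coeConfig]
  exact WilsonPinching.abs_wilsonAction_le (StrongCoupling.defRep n) continuous_subtype_val U

/-- **A Fisher zero of the volume-`L` Wilson partition function within `R` of the real coupling `x`,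
from the variance of the Wilson action under `wilsonMeasure ρ₀ x`**: if
`Var(S_W) > 128(2n·#plaquettes·R + 1)/R²` (`R > 0`) then `Z_L(s₀) = 0` for some `|s₀ - x| < R`.
[ours] -/
theorem wilson_exists_fisherZero_near_of_variance_gt (x : ℝ) {R : ℝ} (hR : 0 < R)
    (hvar : 128 * ((2 * n * Fintype.card (Plaquette d L) : ℝ) * R + 1) / R ^ 2 <
      variance (wilsonAction (StrongCoupling.defRep n))
        (wilsonMeasure (d := d) (L := L) (StrongCoupling.defRep n) x)) :
    ∃ s₀ : ℂ, ‖s₀ - x‖ < R ∧ complexMGF (fun U => -ambWilsonAction (coeConfig U))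
      (trivialMeasure (Matrix.specialUnitaryGroup (Fin n) ℂ) d L) s₀ = 0 := by
  refine exists_actionZ_eq_zero_near_of_variance_gt (d := d) (L := L) (n := n)
    contDiff_ambWilsonAction abs_ambWilsonAction_coeConfig_le x hR ?_
  have hcard : (0 : ℝ) ≤ 2 * n * Fintype.card (Plaquette d L) := by positivity
  rw [abs_of_nonneg hcard, StrongCoupling.boltzmannMeasure_smul_ambWilsonAction x]
  simp_rw [StrongCoupling.ambWilsonAction_coeConfig]
  exact hvar

end Wilson

end Summit.Ventures.LatticeQCDFlow.TrivializingMaps
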